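import Mathlib
import HarnessLib
import Summits.AtomisticToContinuum.Crystallization.Theses.BrittleRungDescent
import Summits.AtomisticToContinuum.Crystallization.Theorems.BrittleRungDescentSoftLayerPropagationCaseFChain
import Summits.AtomisticToContinuum.Crystallization.Theorems.BrittleRungDescentSoftLayerPropagationCaseHAssembly
import Summits.AtomisticToContinuum.Crystallization.Theorems.BrittleRungDescentSoftLayerPropagationCaseHFrame
import Summits.AtomisticToContinuum.Crystallization.Theorems.BrittleRungDescentSoftLayerPropagationLimitShell
import Summits.AtomisticToContinuum.Crystallization.Theorems.BrittleRungDescentSoftLayerPropagationLimitExtraction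
import Summits.AtomisticToContinuum.Crystallization.Theorems.LayeredLawsSelectHcp.Negative.IdealStackings

/-!
# Soft layer propagation (route `BrittleRungDescent`, item `SoftLayerPropagation`)

Closes the support item stmt-AtomisticToContinuum-9210: `softLayerPropagation` proves
`Summit.AtomisticToContinuum.Crystallization.Theses.BrittleRungDescent.SoftLayerPropagation`.

* `ball_barlow` — **the exact local statement (scale 2).**  Let `V` be a packing of unit balls
  with Hales's separation (`dist ∈ {2} ∪ [2.52, ∞)` on pairs), `u` a point and `R ≥ 4`; if every
  centre within `2R − 2` of `u` has an FCC- or HCP-arranged shell, the centres within `R` of `u`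
  lie in a moved close-packed Barlow stacking.  Cases `caseF_ball` (`…CaseFChain.lean`) and
  `caseH_ball` (`…CaseHAssembly.lean`); `exists_deep_centre` supplies the deep centre of Case F.
* `softLayerPropagation` — by compactness from `ball_barlow`.  If the statement failed for some
  `R ≥ 4`, `δ > 0`, there would be configurations `S n`, centres `c n` satisfying the soft
  hypotheses with tolerance `1/(n+2)` but not the conclusion.  Enumerate the points of `S n`
  within `R` of `c n` by a fixed `1/4`-net (`exists_enumeration`), pass to a simultaneous cluster
  point of positions, activity and soft-contact relation (`exists_cluster`); the cluster
  configuration, scaled by `2`, is a packing with Hales's separation whose shells within `2R − 2`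
  are FCC/HCP (`isArrangedIn_fcc_of_limit` / `isArrangedIn_hcp_of_limit`), so `ball_barlow` puts
  its `R`-ball in a moved Barlow stacking; scaling back by `1/2` and translating by `c n`
  contradicts the failure of the conclusion at a time `n` where everything is `δ/2`-close to the
  cluster point.

[cite: HalesDSP2012, §1.3]; the compactness bookkeeping is [folklore].
-/

noncomputable section

namespace Summit.AtomisticToContinuum.Crystallization.Theorems

open Literature.Geometry.DiscreteGeometry Literature.MathematicalPhysics.StatisticalMechanics
open RealInnerProductSpace Filter Topology

/-- **A packing of unit balls meets every ball in a finite set** (cover the ball by finitely many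
balls of radius `1`; each contains at most one centre). [folklore] -/
theorem finite_inter_closedBall_of_packing {V : Set (EuclideanSpace ℝ (Fin 3))} (hV : IsUnitBallPacking V)
    (u : EuclideanSpace ℝ (Fin 3)) (R : ℝ) : (V ∩ Metric.closedBall u R).Finite := by
  obtain ⟨t, htfin, hcover⟩ := Metric.totallyBounded_iff.1
    (isCompact_closedBall u R).totallyBounded 1 one_pos
  classical
  -- send each centre of the ball to a point of `t` within `1`
  have hex : ∀ v ∈ V ∩ Metric.closedBall u R, ∃ y ∈ t, dist v y < 1 := by
    intro v hv
    have := hcover hv.2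
    simp only [Set.mem_iUnion, Metric.mem_ball] at this
    obtain ⟨y, hy, hvy⟩ := this
    exact ⟨y, hy, hvy⟩
  set f : EuclideanSpace ℝ (Fin 3) → EuclideanSpace ℝ (Fin 3) := fun v =>
    if h : v ∈ V ∩ Metric.closedBall u R then (hex v h).choose else v with hf
  have hf1 : ∀ v (h : v ∈ V ∩ Metric.closedBall u R), f v ∈ t ∧ dist v (f v) < 1 := by
    intro v h
    simp only [hf, dif_pos h]
    exact (hex v h).choose_spec
  refine Set.Finite.of_finite_image (f := f) (htfin.subset ?_) ?_
  · rintro _ ⟨v, hv, rfl⟩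
    exact (hf1 v hv).1
  · intro v hv w hw hvw
    apply hV hv.1 hw.1
    calc dist v w ≤ dist v (f v) + dist w (f w) := by rw [hvw]; exact dist_triangle_right _ _ _
      _ < 1 + 1 := add_lt_add (hf1 v hv).2 (hf1 w hw).2
      _ = 2 := by norm_num

/-- **A nearest centre is deep inside**: if some centre is within `R` of `u` (`R ≥ 4`) and every
centre within `2R − 2` of `u` has an FCC/HCP shell, some centre is within `√2` of `u`. [folklore] -/
theorem exists_deep_centre {V : Set (EuclideanSpace ℝ (Fin 3))} (hV : IsUnitBallPacking V)
    {u : EuclideanSpace ℝ (Fin 3)} {R : ℝ} (hR : 4 ≤ R)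
    (hpat : ∀ v ∈ V, dist u v < 2 * R - 2 →
      IsArrangedIn (kissingShell V v) fccKissingPattern ∨ IsArrangedIn (kissingShell V v) hcpKissingPattern)
    (hne : ∃ v ∈ V, dist u v ≤ R) :
    ∃ q ∈ V, dist u q ≤ Real.sqrt 2 := by
  obtain ⟨v₀, hv₀, hv₀u⟩ := hne
  have hfin := finite_inter_closedBall_of_packing hV u R
  have hne' : (V ∩ Metric.closedBall u R).Nonempty := ⟨v₀, hv₀, by rw [Metric.mem_closedBall, dist_comm]; exact hv₀u⟩
  obtain ⟨q, ⟨hqV, hqu⟩, hmin⟩ := Set.exists_min_image _ (fun v => dist u v) hfin hne'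
  rw [Metric.mem_closedBall, dist_comm] at hqu
  refine ⟨q, hqV, ?_⟩
  by_contra hlt
  have hlt : Real.sqrt 2 < dist u q := not_le.mp hlt
  obtain ⟨p, hp, hle⟩ := exists_mem_kissingShell_norm_add_sub_sq_le (hpat q hqV (by linarith)) u
  have hs2 : Real.sqrt 2 * Real.sqrt 2 = 2 := Real.mul_self_sqrt (by norm_num)
  have hqn : ‖q - u‖ = dist u q := by rw [dist_comm, dist_eq_norm]
  have hqpn : ‖q + p - u‖ = dist u (q + p) := by rw [dist_comm, dist_eq_norm]
  rw [hqn, hqpn] at hle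
  have hlt' : dist u (q + p) ^ 2 < dist u q ^ 2 := by
    have : 4 < 2 * Real.sqrt 2 * dist u q := by nlinarith [Real.sqrt_nonneg 2]
    linarith
  have h1 : dist u (q + p) < dist u q := (abs_lt_of_sq_lt_sq' hlt' dist_nonneg).2
  have hqp : q + p ∈ V ∩ Metric.closedBall u R :=
    ⟨hp.1, by rw [Metric.mem_closedBall, dist_comm]; linarith⟩
  have := hmin (q + p) hqp
  linarith

/-- **The exact local statement (scale 2)** (see the module docstring): if some HCP shell within
`2R − 2` of `u` has its mirror plane within `R − 3/2` of `u`, `caseH_ball` in the frame of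
`exists_frame_of_range_hcpRef`; otherwise `caseF_ball` at a nearest centre; with no centre within
`R` the statement is empty. [cite: HalesDSP2012, §1.3] -/
theorem ball_barlow {V : Set (EuclideanSpace ℝ (Fin 3))} (hV : IsUnitBallPacking V)
    (hsep : ∀ x ∈ V, ∀ y ∈ V, x = y ∨ dist x y = 2 ∨ 2 * hales_h0 ≤ dist x y)
    {u : EuclideanSpace ℝ (Fin 3)} {R : ℝ} (hR : 4 ≤ R)
    (hpat : ∀ v ∈ V, dist u v < 2 * R - 2 →
      IsArrangedIn (kissingShell V v) fccKissingPattern ∨ IsArrangedIn (kissingShell V v) hcpKissingPattern) :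
    ∃ s : ℤ → ℤ, IsHaggSeq s ∧ ∃ g : EuclideanSpace ℝ (Fin 3) ≃ᵢ EuclideanSpace ℝ (Fin 3),
      ∀ v ∈ V, dist u v ≤ R → v ∈ g '' barlowStacking 2 (2 * Real.sqrt (2 / 3)) s := by
  by_cases hne : ∃ v ∈ V, dist u v ≤ R
  swap
  · push Not at hne
    exact ⟨fun _ => 1, fun _ => Or.inl rfl, IsometryEquiv.refl _,
      fun v hv hvu => absurd hvu (not_le.2 (hne v hv))⟩
  by_cases hQ : ∃ q ∈ V, dist u q < 2 * R - 2 ∧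
      ∃ B : EuclideanSpace ℝ (Fin 3) →ₗᵢ[ℝ] EuclideanSpace ℝ (Fin 3),
        kissingShell V q = Set.range (fun i => B (hcpRef i)) ∧
        |⟪u - q, B ((Real.sqrt 3)⁻¹ • intVec ![1, 1, 1])⟫| ≤ R - 3 / 2
  · -- Case H
    obtain ⟨q, hqV, hdq, B, hB, habs⟩ := hQ
    obtain ⟨L, hshell0, hnonneg, heq⟩ := exists_frame_of_range_hcpRef (V := V) B u hB
    have hD : (L.symm (u - q)) 2 ≤ R - 3 / 2 := by
      have := abs_of_nonneg hnonneg
      rw [← this, heq]; exact habs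
    exact caseH_ball hV hR hqV hpat L (Or.inl rfl) hshell0 hnonneg hD hdq
  · -- Case F
    push Not at hQ
    obtain ⟨q, hqV, hqu⟩ := exists_deep_centre hV hR hpat hne
    exact caseF_ball hV hsep hR hpat (fun v hv hvd B hB => hQ v hv hvd B hB) hqV hqu


/-- **The rescaled, translated rigid motion**: for an isometry `g` of `ℝ³` and a point `c`, the map
`z ↦ c + ½ g(2z)` is an isometry of `ℝ³` onto itself. [folklore] -/
theorem exists_isometryEquiv_half (g : EuclideanSpace ℝ (Fin 3) ≃ᵢ EuclideanSpace ℝ (Fin 3))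
    (c : EuclideanSpace ℝ (Fin 3)) :
    ∃ G : EuclideanSpace ℝ (Fin 3) ≃ᵢ EuclideanSpace ℝ (Fin 3),
      ∀ z, G z = c + (1 / 2 : ℝ) • g ((2 : ℝ) • z) := by
  refine ⟨{ toFun := fun z => c + (1 / 2 : ℝ) • g ((2 : ℝ) • z),
            invFun := fun w => (1 / 2 : ℝ) • g.symm ((2 : ℝ) • (w - c)),
            left_inv := fun z => ?_, right_inv := fun w => ?_, isometry_toFun := ?_ }, fun z => rfl⟩
  · simp only [add_sub_cancel_left, smul_smul, show (2 : ℝ) * (1 / 2) = 1 by norm_num, one_smul,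
      IsometryEquiv.symm_apply_apply, show (1 / 2 : ℝ) * 2 = 1 by norm_num]
  · simp only [smul_smul, show (2 : ℝ) * (1 / 2) = 1 by norm_num, one_smul,
      IsometryEquiv.apply_symm_apply, show (1 / 2 : ℝ) * 2 = 1 by norm_num, add_sub_cancel]
  · refine Isometry.of_dist_eq fun z z' => ?_
    simp only [dist_add_left, dist_smul₀, g.dist_eq]
    simp

/-- **Soft layer propagation** (closes item stmt-AtomisticToContinuum-9210 of route
`BrittleRungDescent`; see the module docstring for the proof). [cite: HalesDSP2012, §1.3] -/
theorem softLayerPropagation :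
    Summit.AtomisticToContinuum.Crystallization.Theses.BrittleRungDescent.SoftLayerPropagation := by
  intro R hR δ hδ
  by_contra hcon
  push Not at hcon
  choose S c hH hN using fun n : ℕ => hcon (1 / ((n : ℝ) + 2)) (by positivity)
  -- the tolerances
  have hη2 : ∀ n : ℕ, 1 / ((n : ℝ) + 2) ≤ 1 / 2 := fun n =>
    one_div_le_one_div_of_le (by norm_num) (by linarith [n.cast_nonneg (α := ℝ)])
  have hηev : ∀ ε > 0, ∀ᶠ n : ℕ in atTop, 1 / ((n : ℝ) + 2) < ε := by
    intro ε hε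
    rw [Filter.eventually_atTop]
    refine ⟨⌈1 / ε⌉₊, fun n hn => ?_⟩
    have h1 : 1 / ε ≤ ⌈1 / ε⌉₊ := Nat.le_ceil _
    have h2 : (⌈1 / ε⌉₊ : ℝ) ≤ n := by exact_mod_cast hn
    rw [div_lt_iff₀ (by positivity)]
    have h3 : 1 / ε < (n : ℝ) + 2 := by linarith
    rw [div_lt_iff₀ hε] at h3
    linarith
  -- the net and the enumerations
  obtain ⟨t, ht⟩ := exists_quarter_net R
  have hgap : ∀ n, ∀ v ∈ S n, dist v (c n) ≤ R → ∀ w ∈ S n, w ≠ v → 1 / 2 ≤ dist v w := by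
    intro n v hv hvc w hw hwv
    have := ((hH n v hv hvc).1.1 w hw hwv).1
    linarith [hη2 n]
  choose D Y hDY hcov hinj hzero using fun n => exists_enumeration (S := S n) (c := c n) t ht (hgap n)
  set A : ℕ → ↥t → ↥t → Bool := fun n y y' => decide (dist (Y n y) (Y n y') ≤ 1 + 1 / ((n : ℝ) + 2))
    with hA
  have hYb : ∀ n y, ‖Y n y‖ ≤ R := by
    intro n y
    cases hy : D n y
    · rw [hzero n y hy, norm_zero]; linarith
    · exact (hDY n y hy).2
  obtain ⟨⟨Dl, Al⟩, X, hfreq⟩ := exists_cluster (fun n => (D n, A n)) Y (by linarith) hYb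
  -- simultaneous approximation
  have hget : ∀ ε > 0, ∃ n, D n = Dl ∧ A n = Al ∧ (∀ y, dist (Y n y) (X y) < ε) ∧ 1 / ((n : ℝ) + 2) < ε := by
    intro ε hε
    obtain ⟨n, ⟨hτ, hd⟩, hηn⟩ := ((hfreq ε hε).and_eventually (hηev ε hε)).exists
    exact ⟨n, (Prod.mk.inj hτ).1, (Prod.mk.inj hτ).2, hd, hηn⟩
  -- the limit facts: distances between distinct active cluster points
  have hdist : ∀ y y', Dl y = true → Dl y' = true → y ≠ y' →
      (Al y y' = true → dist (X y) (X y') = 1) ∧ (¬Al y y' = true → 1.26 ≤ dist (X y) (X y')) := by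
    intro y y' hy hy' hne
    have happrox : ∀ ε > 0, 1 - 3 * ε ≤ dist (X y) (X y') ∧
        (Al y y' = true → dist (X y) (X y') ≤ 1 + 3 * ε) ∧
        (Al y y' = false → 1.26 - 2 * ε ≤ dist (X y) (X y')) := by
      intro ε hε
      obtain ⟨n, hD, hAe, hclose, hηn⟩ := hget ε hε
      have hyD : D n y = true := by rw [hD]; exact hy
      have hy'D : D n y' = true := by rw [hD]; exact hy'
      obtain ⟨hvS, hvR⟩ := hDY n y hyD
      obtain ⟨hwS, -⟩ := hDY n y' hy'D
      have hne' : c n + Y n y' ≠ c n + Y n y := fun h =>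
        hne (hinj n y y' hyD hy'D (add_left_cancel h).symm)
      have hvc : dist (c n + Y n y) (c n) ≤ R := by simpa [dist_eq_norm] using hvR
      obtain ⟨hg1, hg2⟩ := (hH n (c n + Y n y) hvS hvc).1.1 (c n + Y n y') hwS hne'
      have hdvw : dist (c n + Y n y) (c n + Y n y') = dist (Y n y) (Y n y') := by simp [dist_eq_norm]
      rw [hdvw] at hg1 hg2
      have hAn : Al y y' = decide (dist (Y n y) (Y n y') ≤ 1 + 1 / ((n : ℝ) + 2)) := by
        rw [← hAe]
      have htri : |dist (Y n y) (Y n y') - dist (X y) (X y')| ≤ 2 * ε := by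
        have h1 := abs_dist_sub_le (Y n y) (X y) (Y n y')
        have h2 := abs_dist_sub_le (Y n y') (X y') (X y)
        rw [dist_comm (X y) (Y n y')] at h1
        rw [dist_comm (X y') (X y)] at h2
        have h3 := hclose y
        have h4 := hclose y'
        rw [abs_le] at h1 h2 ⊢
        constructor <;> linarith [h1.1, h1.2, h2.1, h2.2]
      rw [abs_le] at htri
      refine ⟨by linarith, fun hAt => ?_, fun hAf => ?_⟩
      · rw [hAn] at hAt
        have := of_decide_eq_true hAt
        linarith
      · rw [hAn] at hAf
        have := of_decide_eq_false hAf
        rcases hg2 with h | h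
        · exact absurd h this
        · norm_num at h; linarith
    have h1 : 1 ≤ dist (X y) (X y') :=
      le_of_forall_pos_le_add fun ε hε => by linarith [(happrox (ε / 3) (by positivity)).1]
    refine ⟨fun hAt => le_antisymm ?_ h1, fun hAf => ?_⟩
    · exact le_of_forall_pos_le_add fun ε hε => by
        linarith [(happrox (ε / 3) (by positivity)).2.1 hAt]
    · have hAf' : Al y y' = false := by simpa using hAf
      exact le_of_forall_pos_le_add fun ε hε => by
        linarith [(happrox (ε / 2) (by positivity)).2.2 hAf']
  -- the limit configuration (scale `2`)
  set V : Set (EuclideanSpace ℝ (Fin 3)) := (fun j => (2 : ℝ) • X j) '' {j | Dl j = true} with hVdef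
  have hd2 : ∀ j j', dist ((2 : ℝ) • X j) ((2 : ℝ) • X j') = 2 * dist (X j) (X j') := by
    intro j j'; rw [dist_smul₀]; norm_num
  have hV : IsUnitBallPacking V := by
    rintro _ ⟨j, hj, rfl⟩ _ ⟨j', hj', rfl⟩ hlt
    by_cases hjj : j = j'
    · rw [hjj]
    · have := limit_one_le_dist hdist hj hj' hjj
      rw [hd2] at hlt
      linarith
  have hsep : ∀ x ∈ V, ∀ y ∈ V, x = y ∨ dist x y = 2 ∨ 2 * hales_h0 ≤ dist x y := by
    rintro _ ⟨j, hj, rfl⟩ _ ⟨j', hj', rfl⟩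
    by_cases hjj : j = j'
    · left; rw [hjj]
    · right
      rw [hd2]
      by_cases hAjj : Al j j' = true
      · left; rw [(hdist j j' hj hj' hjj).1 hAjj]; norm_num
      · right; rw [hales_h0_eq]; linarith [(hdist j j' hj hj' hjj).2 hAjj]
  -- shells of cluster points within `R − 1` are FCC/HCP
  have hpat : ∀ v ∈ V, dist 0 v < 2 * R - 2 →
      IsArrangedIn (kissingShell V v) fccKissingPattern ∨ IsArrangedIn (kissingShell V v) hcpKissingPattern := by
    rintro _ ⟨y, hy, rfl⟩ hvR
    have hXy : ‖X y‖ < R - 1 := by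
      rw [dist_zero_left, norm_smul, Real.norm_two] at hvR; linarith
    set ε : ℝ := (R - 1 - ‖X y‖) / 4 with hε
    have hε0 : 0 < ε := by rw [hε]; linarith
    obtain ⟨n, hD, hAe, hclose, hηn⟩ := hget ε hε0
    have hyD : D n y = true := by rw [hD]; exact hy
    obtain ⟨hvS, hvR'⟩ := hDY n y hyD
    have hYy : ‖Y n y‖ < ‖X y‖ + ε := by
      have := hclose y
      rw [dist_eq_norm] at this
      calc ‖Y n y‖ = ‖(Y n y - X y) + X y‖ := by rw [sub_add_cancel]
        _ ≤ ‖Y n y - X y‖ + ‖X y‖ := norm_add_le _ _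
        _ < ‖X y‖ + ε := by linarith
    have hvc : dist (c n + Y n y) (c n) ≤ R := by
      rw [dist_eq_norm, add_sub_cancel_left]; linarith
    -- the soft neighbours of `v = c n + Y n y` are enumerated by the `Al`-neighbours of `y`
    set v : EuclideanSpace ℝ (Fin 3) := c n + Y n y with hv
    set J := {j : ↥t // Dl j = true ∧ j ≠ y ∧ Al y j = true} with hJ
    set W := {w : EuclideanSpace ℝ (Fin 3) // w ∈ S n ∧ w ≠ v ∧ dist v w ≤ 1 + 1 / ((n : ℝ) + 2)} with hW
    have hdistY : ∀ j j' : ↥t, dist (c n + Y n j) (c n + Y n j') = dist (Y n j) (Y n j') := by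
      intro j j'; simp [dist_eq_norm]
    have hAiff : ∀ j j' : ↥t, Al j j' = true ↔ dist (Y n j) (Y n j') ≤ 1 + 1 / ((n : ℝ) + 2) := by
      intro j j'; rw [← hAe]; simp [hA]
    have βmem : ∀ j : J, c n + Y n j.1 ∈ S n ∧ c n + Y n j.1 ≠ v ∧
        dist v (c n + Y n j.1) ≤ 1 + 1 / ((n : ℝ) + 2) := by
      intro j
      have hjD : D n j.1 = true := by rw [hD]; exact j.2.1
      refine ⟨(hDY n j.1 hjD).1, fun h => j.2.2.1 (hinj n j.1 y hjD hyD (add_left_cancel h)), ?_⟩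
      rw [hv, hdistY]; exact (hAiff y j.1).1 j.2.2.2
    set β : J → W := fun j => ⟨c n + Y n j.1, βmem j⟩ with hβ
    have hβinj : Function.Injective β := by
      intro j j' h
      have h1 : c n + Y n j.1 = c n + Y n j'.1 := congrArg Subtype.val h
      have hjD : D n j.1 = true := by rw [hD]; exact j.2.1
      have hj'D : D n j'.1 = true := by rw [hD]; exact j'.2.1
      exact Subtype.ext (hinj n j.1 j'.1 hjD hj'D (add_left_cancel h1))
    have hβsurj : Function.Surjective β := by
      rintro ⟨w, hwS, hwv, hwd⟩
      have hwc : dist w (c n) ≤ R := by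
        have h1 : dist w (c n) ≤ dist w v + dist v (c n) := dist_triangle _ _ _
        have h2 : dist v (c n) = ‖Y n y‖ := by rw [hv, dist_eq_norm, add_sub_cancel_left]
        rw [dist_comm w v] at h1
        have h3 : 1 / ((n : ℝ) + 2) < ε := hηn
        linarith
      obtain ⟨j, hjD, hjw⟩ := hcov n w hwS hwc
      have hjl : Dl j = true := by rw [← hD]; exact hjD
      have hjy : j ≠ y := by rintro rfl; exact hwv (by rw [← hjw])
      have hAyj : Al y j = true := by
        rw [hAiff, ← hdistY, hjw]; exact hwd
      exact ⟨⟨j, hjl, hjy, hAyj⟩, Subtype.ext hjw⟩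
    set βe := Equiv.ofBijective β ⟨hβinj, hβsurj⟩ with hβe
    have hβe1 : ∀ j : J, ((βe j : W) : EuclideanSpace ℝ (Fin 3)) = c n + Y n j.1 := fun j => rfl
    -- transport of the soft pattern
    have key : ∀ (P : Finset (EuclideanSpace ℝ (Fin 3)))
        (e : W ≃ {q : EuclideanSpace ℝ (Fin 3) // q ∈ P}),
        (∀ w w' : W, w ≠ w' → (dist w.1 w'.1 ≤ 1 + 1 / ((n : ℝ) + 2) ↔ dist (e w).1 (e w').1 = 1)) →
        ∀ j j' : J, j ≠ j' → (Al j.1 j'.1 = true ↔ dist ((βe.trans e) j).1 ((βe.trans e) j').1 = 1) := by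
      intro P e he j j' hjj
      rw [Equiv.trans_apply, Equiv.trans_apply, ← he (βe j) (βe j') (fun h => hjj (βe.injective h)),
        hβe1, hβe1, hdistY]
      exact hAiff j.1 j'.1
    rcases (hH n v hvS hvc).2 with ⟨e, he⟩ | ⟨e, he⟩
    · left
      exact isArrangedIn_fcc_of_limit hdist hy (βe.trans e) (key _ e he)
    · right
      exact isArrangedIn_hcp_of_limit hdist hy (βe.trans e) (key _ e he)
  -- the exact local statement for the limit configuration
  obtain ⟨s, hs, g, hg⟩ := ball_barlow hV hsep hR hpat (u := 0)
  -- a time `n` at which everything is close to the cluster point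
  classical
  set m : ℝ := if hm : (Finset.univ.filter fun j : ↥t => R / 2 < ‖X j‖).Nonempty then
      (Finset.univ.filter fun j : ↥t => R / 2 < ‖X j‖).inf' hm (fun j => ‖X j‖ - R / 2) else 1 with hmdef
  have hm0 : 0 < m := by
    rw [hmdef]; split_ifs with hm
    · rw [Finset.lt_inf'_iff]
      intro j hj
      rw [Finset.mem_filter] at hj
      linarith [hj.2]
    · norm_num
  have hmle : ∀ j : ↥t, R / 2 < ‖X j‖ → m ≤ ‖X j‖ - R / 2 := by
    intro j hj
    have hmem : j ∈ Finset.univ.filter fun j : ↥t => R / 2 < ‖X j‖ := by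
      rw [Finset.mem_filter]; exact ⟨Finset.mem_univ _, hj⟩
    rw [hmdef, dif_pos ⟨j, hmem⟩]
    exact Finset.inf'_le _ hmem
  obtain ⟨n, hD, -, hclose, -⟩ := hget (min (δ / 2) m) (lt_min (by linarith) hm0)
  obtain ⟨G, hG⟩ := exists_isometryEquiv_half g (c n)
  obtain ⟨v, hvS, hvc, hfar⟩ := hN n s G.toRealAffineIsometryEquiv hs
  -- `v` is an enumerated point whose cluster point is covered by the stacking
  obtain ⟨j, hjD, hjv⟩ := hcov n v hvS (by linarith)
  have hjl : Dl j = true := by rw [← hD]; exact hjD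
  have hYj : ‖Y n j‖ ≤ R / 2 := by
    rw [← hjv, dist_eq_norm, add_sub_cancel_left] at hvc; exact hvc
  have hcj := hclose j
  have hXj : ‖X j‖ ≤ R / 2 := by
    by_contra hlt
    push Not at hlt
    have h1 := hmle j hlt
    have h2 : ‖X j‖ ≤ ‖Y n j‖ + dist (Y n j) (X j) := by
      rw [dist_eq_norm]
      calc ‖X j‖ = ‖Y n j - (Y n j - X j)‖ := by rw [sub_sub_cancel]
        _ ≤ ‖Y n j‖ + ‖Y n j - X j‖ := norm_sub_le _ _
    have h3 : dist (Y n j) (X j) < m := lt_of_lt_of_le hcj (min_le_right _ _)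
    linarith
  have hmemV : (2 : ℝ) • X j ∈ V := ⟨j, hjl, rfl⟩
  obtain ⟨z, hz, hgz⟩ := hg _ hmemV (by rw [dist_zero_left, norm_smul, Real.norm_two]; linarith)
  obtain ⟨k, a, b, rfl⟩ := hz
  have hfar' := hfar (barlowPos 1 (Real.sqrt (2 / 3)) s k a b) ⟨k, a, b, rfl⟩
  have hGz : G.toRealAffineIsometryEquiv (barlowPos 1 (Real.sqrt (2 / 3)) s k a b) = c n + X j := by
    rw [IsometryEquiv.coeFn_toRealAffineIsometryEquiv, hG,
      LayeredLawsSelectHcp.Negative.IdealStackings.barlowPos_smul 2 (Real.sqrt (2 / 3)), hgz, smul_smul]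
    norm_num
  rw [hGz, ← hjv, dist_add_left] at hfar'
  linarith [min_le_left (δ / 2) m]

end Summit.AtomisticToContinuum.Crystallization.Theorems
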